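import Summits.ABC.ABC.Theses.GaussianTwoDivision
import Literature.NumberTheory.DiophantineGeometry.MinimalDiscriminantProofs
import HarnessLib

/-!
# Route `GaussianTwoDivision` — item `GaussianPayoff` (stmt-ABC-23403): the payoff glue

`Summit.ABC.ABC.Theses.GaussianTwoDivision.GaussianPayoff :=
GaussianNormTripleBound → TwoTorsionDictionary → GaussianClassEpsShape`.

Elementary bookkeeping (critic idea-crit-6, 2026-08-27: "provable-now glue"). For coprime `a, b`
and `m ≠ 0` with `a² + m² = 4b` one has `b > 0`, `a² − 4b = −m² ≠ 0`, so the two-torsion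
dictionary applies to `W = ⟨0, a, 0, b, 0⟩`: `|Δ_min (W)| ≤ |16 b² (a² − 4b)| = 16 b² m² ≤ 64 b³`
(as `m² ≤ 4b`), whence `log |Δ_min| ≤ log 64 + 3 log b`; and `rad (b m) ∣ rad (b (a² − 4b))`
(`b (a² − 4b) = (b m) · (−m)`) divides `2 N_W`, so `rad (b m) ≤ 2 N_W`. For `b ≥ c₀` the triple
bound gives `log b ≤ κ · rad (b m) ^ (2/3 + ε) ≤ max (κ, 0) · (2 N_W) ^ (2/3 + ε)`; for `b < c₀`,
`log b ≤ log c₀`. Since `N_W ≥ 1`, everything is `≤ C · N_W ^ (2/3 + ε)` with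
`C = log 64 + 3 (max (log c₀, 0) + max (κ, 0) · 2 ^ (2/3 + ε))`.

HONESTY. Glue on a thin two-torsion class; the class ε-shape `GaussianClassEpsShape` it serves is
NOT abc and NOT A-PS, and is itself only reached modulo the crux `GaussianNormTripleBound` (not
claimed here). abc is not proved by any of this; moves no rung.

## References

* J. H. Silverman, *The Arithmetic of Elliptic Curves*, GTM 106, 2nd ed. 2009, VII.1, VIII.8.
  [SilvermanAEC2009]
-/

-- `Summit.<Summit>.<Problem>` is the mandated summit-side namespace (CONVENTIONS §2); for the
-- single-conjunct summit `ABC` the two coincide, so the duplicate `ABC.ABC` is deliberate.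
set_option linter.dupNamespace false

namespace Summit.ABC.ABC.Theorems

open UniqueFactorizationMonoid
open Summit.ABC.ABC.Theses.GaussianTwoDivision

namespace GaussianPayoff

/-! ### Integer bookkeeping on the Gaussian class `a² + m² = 4b` -/

/-- On the Gaussian class, `0 < b` (as `4b = a² + m² ≥ m² > 0`). [folklore] -/
theorem b_pos {a b m : ℤ} (hm : m ≠ 0) (h : a ^ 2 + m ^ 2 = 4 * b) : 0 < b := by
  have hm2 : 0 < m ^ 2 := by positivity
  nlinarith [sq_nonneg a]

/-- On the Gaussian class, `a² − 4b = −m²`. [folklore] -/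
theorem sq_sub_four_mul_eq {a b m : ℤ} (h : a ^ 2 + m ^ 2 = 4 * b) : a ^ 2 - 4 * b = -m ^ 2 := by
  linarith

/-- On the Gaussian class, `a² − 4b ≠ 0`. [folklore] -/
theorem sq_sub_four_mul_ne_zero {a b m : ℤ} (hm : m ≠ 0) (h : a ^ 2 + m ^ 2 = 4 * b) :
    a ^ 2 - 4 * b ≠ 0 := by
  rw [sq_sub_four_mul_eq h]
  exact neg_ne_zero.mpr (pow_ne_zero 2 hm)

/-- On the Gaussian class, `|16 b² (a² − 4b)| ≤ 64 b³` as real numbers (`m² ≤ 4b`). [folklore] -/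
theorem abs_disc_le {a b m : ℤ} (h : a ^ 2 + m ^ 2 = 4 * b) :
    |(16 : ℝ) * (b : ℝ) ^ 2 * ((a : ℝ) ^ 2 - 4 * (b : ℝ))| ≤ 64 * (b : ℝ) ^ 3 := by
  have h' : ((a : ℝ)) ^ 2 + (m : ℝ) ^ 2 = 4 * (b : ℝ) := by exact_mod_cast h
  have hm2 : (m : ℝ) ^ 2 ≤ 4 * (b : ℝ) := by nlinarith [sq_nonneg (a : ℝ)]
  have hb0 : 0 ≤ (b : ℝ) := by nlinarith [sq_nonneg (a : ℝ), sq_nonneg (m : ℝ)]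
  have hd : (a : ℝ) ^ 2 - 4 * (b : ℝ) = -(m : ℝ) ^ 2 := by linarith
  rw [hd, show (16 : ℝ) * (b : ℝ) ^ 2 * -(m : ℝ) ^ 2 = -(16 * (b : ℝ) ^ 2 * (m : ℝ) ^ 2) by ring,
    abs_neg, abs_of_nonneg (by positivity)]
  nlinarith [sq_nonneg (b : ℝ)]

/-- On the Gaussian class, `rad (b m) ∣ rad (b (a² − 4b))` in `ℤ` (indeed
`b (a² − 4b) = (b m) · (−m)`), hence in `ℕ` through `natAbs`. [folklore] -/
theorem natAbs_radical_dvd {a b m : ℤ} (hb : b ≠ 0) (hm : m ≠ 0) (h : a ^ 2 + m ^ 2 = 4 * b) :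
    (radical (b * m)).natAbs ∣ (radical (b * (a ^ 2 - 4 * b))).natAbs := by
  refine Int.natAbs_dvd_natAbs.mpr (radical_dvd_radical ⟨-m, ?_⟩
    (mul_ne_zero hb (sq_sub_four_mul_ne_zero hm h)))
  rw [sq_sub_four_mul_eq h]
  ring

/-! ### Real bookkeeping -/

/-- `log D ≤ log 64 + 3 log b` from `0 < D ≤ 64 b³`, `0 < b`. [folklore] -/
theorem log_le_of_le_cube {D b : ℝ} (hD : 0 < D) (hb : 0 < b) (h : D ≤ 64 * b ^ 3) :
    Real.log D ≤ Real.log 64 + 3 * Real.log b := by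
  have h1 : Real.log D ≤ Real.log (64 * b ^ 3) := Real.log_le_log hD h
  rw [Real.log_mul (by norm_num) (by positivity), Real.log_pow] at h1
  exact_mod_cast h1

/-- The case split on `c₀ ≤ b`: `log b ≤ max (log c₀) 0 + max κ 0 · (2N) ^ e` from the triple
bound on `[c₀, ∞)`, `r ≤ 2N`, `1 ≤ b`, `0 ≤ e`. [folklore] -/
theorem log_b_le {b c₀ κ r N e : ℝ} (hb : 1 ≤ b) (hr0 : 0 ≤ r) (hrN : r ≤ 2 * N) (he : 0 ≤ e)
    (htriple : c₀ ≤ b → Real.log b ≤ κ * r ^ e) :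
    Real.log b ≤ max (Real.log c₀) 0 + max κ 0 * (2 * N) ^ e := by
  have hpow : 0 ≤ (2 * N) ^ e := Real.rpow_nonneg (hr0.trans hrN) e
  have hsecond : 0 ≤ max κ 0 * (2 * N) ^ e := mul_nonneg (le_max_right _ _) hpow
  by_cases hc : c₀ ≤ b
  · have h1 : Real.log b ≤ κ * r ^ e := htriple hc
    have h2 : κ * r ^ e ≤ max κ 0 * r ^ e :=
      mul_le_mul_of_nonneg_right (le_max_left _ _) (Real.rpow_nonneg hr0 e)
    have h3 : max κ 0 * r ^ e ≤ max κ 0 * (2 * N) ^ e :=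
      mul_le_mul_of_nonneg_left (Real.rpow_le_rpow hr0 hrN he) (le_max_right _ _)
    linarith [le_max_right (Real.log c₀) 0]
  · have hlt : b < c₀ := lt_of_not_ge hc
    have h1 : Real.log b ≤ Real.log c₀ := Real.log_le_log (by linarith) hlt.le
    linarith [le_max_left (Real.log c₀) 0]

/-- Final assembly of the constant: with `C = log 64 + 3 (max (log c₀) 0 + max κ 0 · 2 ^ e)` and
`1 ≤ N`, `log 64 + 3 (max (log c₀) 0 + max κ 0 (2N) ^ e) ≤ C · N ^ e`. [folklore] -/
theorem const_bound {c₀ κ N e : ℝ} (hN : 1 ≤ N) (he : 0 ≤ e) :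
    Real.log 64 + 3 * (max (Real.log c₀) 0 + max κ 0 * (2 * N) ^ e) ≤
      (Real.log 64 + 3 * (max (Real.log c₀) 0 + max κ 0 * 2 ^ e)) * N ^ e := by
  have hN0 : 0 ≤ N := zero_le_one.trans hN
  have hNe : 1 ≤ N ^ e := Real.one_le_rpow hN he
  have h64 : 0 ≤ Real.log 64 := Real.log_nonneg (by norm_num)
  have hsplit : (2 * N) ^ e = 2 ^ e * N ^ e := Real.mul_rpow (by norm_num) hN0
  rw [hsplit]
  have hA : Real.log 64 ≤ Real.log 64 * N ^ e := le_mul_of_one_le_right h64 hNe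
  have hB : max (Real.log c₀) 0 ≤ max (Real.log c₀) 0 * N ^ e :=
    le_mul_of_one_le_right (le_max_right _ _) hNe
  have hK : 0 ≤ max κ 0 * 2 ^ e := mul_nonneg (le_max_right _ _) (Real.rpow_nonneg (by norm_num) e)
  nlinarith [hA, hB, hK, hNe]

/-! ### The payoff -/

/-- **`GaussianNormTripleBound → TwoTorsionDictionary → GaussianClassEpsShape`** (unfolded route
decls): the triple bound and the dictionary give Szpiro's ε-shape with exponent `2/3` on the
Gaussian two-division class, with the constant
`C = log 64 + 3 (max (log c₀) 0 + max κ 0 · 2 ^ (2/3 + ε))`. [folklore] -/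
theorem gaussianPayoff (h₁ : GaussianNormTripleBound) (h₂ : TwoTorsionDictionary) :
    GaussianClassEpsShape := by
  intro ε hε
  obtain ⟨κ, c₀, hκ⟩ := h₁ ε hε
  set e : ℝ := 2 / 3 + ε with he_def
  have he : 0 ≤ e := by rw [he_def]; positivity
  refine ⟨Real.log 64 + 3 * (max (Real.log c₀) 0 + max κ 0 * 2 ^ e), ?_⟩
  intro a b m hab hm h W _ hW
  have hb : 0 < b := b_pos hm h
  have hb0 : b ≠ 0 := hb.ne'
  have hd : a ^ 2 - 4 * b ≠ 0 := sq_sub_four_mul_ne_zero hm h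
  obtain ⟨hΔ, hrad⟩ := h₂ a b hab hb0 hd W hW
  -- positivity of the invariants
  have hD : 0 < (W.minimalDiscriminantNorm ℤ : ℝ) := by
    exact_mod_cast WeierstrassCurve.minimalDiscriminantNorm_pos_holds W
  have hNpos : 0 < W.conductorNorm ℤ := WeierstrassCurve.conductorNorm_pos_holds W
  have hN1 : (1 : ℝ) ≤ (W.conductorNorm ℤ : ℝ) := by exact_mod_cast hNpos
  have hb1 : (1 : ℝ) ≤ (b : ℝ) := by exact_mod_cast hb
  -- `|Δ_min| ≤ 64 b³`
  have hDle : (W.minimalDiscriminantNorm ℤ : ℝ) ≤ 64 * (b : ℝ) ^ 3 := hΔ.trans (abs_disc_le h)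
  -- `rad (b m) ≤ 2 N`
  have hr_dvd : (radical (b * m)).natAbs ∣ 2 * W.conductorNorm ℤ :=
    (natAbs_radical_dvd hb0 hm h).trans hrad
  have hrN : (((radical (b * m)).natAbs : ℕ) : ℝ) ≤ 2 * (W.conductorNorm ℤ : ℝ) := by
    exact_mod_cast Nat.le_of_dvd (by positivity) hr_dvd
  -- assemble
  have hlogD := log_le_of_le_cube hD (by linarith) hDle
  have hlogb := log_b_le hb1 (Nat.cast_nonneg _) hrN he (hκ a b m hab hm h)
  have hC := const_bound (c₀ := c₀) (κ := κ) hN1 he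
  linarith

end GaussianPayoff

/-- **Closes stmt-ABC-23403**: `Summit.ABC.ABC.Theses.GaussianTwoDivision.GaussianPayoff` — the
triple bound and the two-torsion dictionary give the class ε-shape (glue; NOT abc, moves no rung;
the class theorem itself remains conditional on the crux `GaussianNormTripleBound`). [folklore] -/
theorem gaussianPayoff_proof : Summit.ABC.ABC.Theses.GaussianTwoDivision.GaussianPayoff := by
  unfold Summit.ABC.ABC.Theses.GaussianTwoDivision.GaussianPayoff
  exact GaussianPayoff.gaussianPayoff

end Summit.ABC.ABC.Theorems
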